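import Mathlib
import HarnessLib
import Summits.Langlands.Langlands.Theses.HolomorphicShadow

/-!
# Line `defect` for crux stmt-Langlands-11630
`Summit.Langlands.Langlands.Theses.HolomorphicShadow.ShadowConverse` — EQUIVARIANCE-FIRST / VANISHING-TOEPLITZ line

Registered by the crux strategist (unit `cstrat-stmt-Langlands-11630-s1`) as an ALTERNATIVE to the live line
`Lines/birth.lean`; it does not touch that skeleton. Route `route-Langlands-HolomorphicShadow`
(`closes : ShadowModularity → ShadowConverse → SectorComplement → Langlands`; this crux is `hSC`, rank 3).

THE CRUX: for `N ∣ L`, `χ mod N`, `ψ mod L`, `ε = ±1`, `‖a_n‖ ≤ C(n+1)^A`, any `k₀` — if for every `k ≥ k₀` and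
every `g ∈ S_k(Γ₀(L), ψ)` (four-clause sense) the typed shadow `H = Σ c_m q^m` converges and lies in
`S_k(Γ₀(L), χψ)`, then the Maass lift `φ = φ_(a,ε)` satisfies `φ(γz) = χ(d_γ) φ(z)` on `Γ₀(L)`.

THE LINE (refuters' §6 skeleton of CruxAttack_ShadowConverse.md, typed; "defect" = `δ_γ := ψ(d)·φ∘γ − χ(d)ψ(d)·φ`).
The typed shadow of `g` IS the weight-`k` BERGMAN PROJECTION `P_k(φ g)` of `φ·g` on the WHOLE upper half-plane
(Sturm's constant `(4πm)^{k-1}/Γ(k-1)` is exactly the one produced by Lipschitz's formula for the `Γ_∞`-periodised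
Bergman kernel), and `P_k` is `SL₂(ℝ)`-EQUIVARIANT for the weight-`k` action. Hence shadow-modularity of `g ↦ P_k(φ g)`
plus modularity of `g` give, by pure algebra, `P_k(δ_γ · g) = 0` for EVERY `g ∈ S_k(Γ₀(L), ψ)` and every large `k`:
the Toeplitz operators of the defect `δ_γ` vanish on the automorphic vectors. Testing this on the Poincaré series
`G_{k,z}` of the Bergman kernel (a cusp form in `S_k(Γ₀(L), ψ)`) and evaluating AT THE SAME POINT `z` gives
`0 = P_k(δ_γ G_{k,z})(z) = 2 K_k(z,z) · (B_k δ_γ(z) + o(1))` at every FREE point `z` (the `o(1)` = off-diagonal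
orbit terms, killed by `cosh(d(z,γ'z)/4)^{-k}` against crude orbit counting), so `B_k δ_γ(z) → 0` along the parity
class of `ψ`; Berezin localisation `B_k δ_γ(z) → δ_γ(z)` gives `δ_γ = 0` at free points, density + continuity
everywhere, and `ψ(d) ≠ 0` finishes.

What this dodges relative to `birth` (whose heart `stub_covariantSymbol` must PRODUCE exactly `χ`-covariant
symbols `σ_j` and control the NORMALISED covariant symbol `(A_k K^ψ_z)(z)/K^ψ_z(z)`, denominator included): here
covariance is spent once, algebraically, BEFORE any analysis (`P_k(δ_γ g) = 0`); nothing is ever divided by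
`K^ψ_z(z)`; the analytic heart is the hypothesis-free asymptotic `stub_offDiagonalDecay` about ONE explicit
test vector, separated from the modular-forms infrastructure (`stub_poincareKernel_isCusp`) and from the
`ℍ`-analysis (`stub_shadow_eq_bergmanProj`, `stub_bergmanProj_slash`).

Stubs (the ONLY sorries):
* `stub_maassLiftModerateGrowth` (M) — `φ_(a,ε)` is continuous and of MODERATE GROWTH in the `SL₂(ℤ)`-stable
  sense: `‖φ(γz)‖ ≤ C_γ cosh(d(z,i))^{A'}` for every `γ ∈ SL₂(ℤ)`.
* `stub_shadow_eq_bergmanProj` (L) — from some weight `k₁(A)` on, for every four-clause `g`: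
  `shadow a ε k b = P_k(φ g)` as functions on `ℍ`, the defining integrals converging absolutely (Sturm's
  coefficient formula + Lipschitz + unfolding of the strip).
* `stub_bergmanProj_slash` (M) — `P_k((F∘γ)·J_γ^{-k}) = (P_k F)∘γ · J_γ^{-k}` for `γ ∈ SL₂(ℤ)` (change of
  variables; Bergman cocycle; `SMulInvariantMeasure`).
* `stub_poincareKernel_isCusp` (L) — Petersson: from some `k₂` on, the Poincaré series
  `G_{k,z}(w) = Σ_{γ∈Γ₀(L)} ψ(d_γ)⁻¹ J(γ,w)^{-k} K_k(γw, z)` is a four-clause cusp form in `S_k(Γ₀(L), ψ)`.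
* `stub_offDiagonalDecay` (L, THE HEART) — for continuous `D` of moderate growth and a FREE point `z`:
  `P_k(D·G_{k,z})(z) / (2K_k(z,z)) − B_k D(z) → 0` as `k → ∞` through the parity class of `ψ`.
* `stub_berezinLocalization_moderate` (L) — `B_k D(z₀) → D(z₀)` for continuous `D` of moderate growth
  (a strengthening of the route's support item `BerezinLocalization`, which is the periodic-growth case).
* `stub_freePointsDense` (M) — verbatim the statement of line `birth`: free points of `Γ₀(L)` are dense.
* `ShadowConverse_of : stubs → ShadowConverse` — kernel-checked, no `sorry`.

Disproof used: none relevant — the crux has no `Disproof.lean` / `Negative/` lemma and `ledger negatives --problem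
Langlands` does not touch this line (checked 2026-08-17). Refuter findings honoured (CruxAttack/Evidence_ShadowConverse.md):
`ε = ±1` unused; `0 < N` unused; the parity class of `ψ` is where the test vectors live (`stub_offDiagonalDecay` is
stated along `k = 2j + r`, `ψ(-1) = (-1)^r`; in the wrong parity `G_{k,z} ≡ 0` and the stub would be false);
all thresholds existential (checklist 4c(iv)); junk values of `∫`/`∑'` below the thresholds are irrelevant
because every analytic stub is a statement about LARGE `k` or a limit.
-/

set_option linter.dupNamespace false

noncomputable section

namespace Summit.Langlands.Langlands.Cruxes.ShadowConverse.Defect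

open Summit.Langlands.Langlands.Theses.HolomorphicShadow
open scoped BigOperators Topology Manifold Classical MeasureTheory ProbabilityTheory Matrix InnerProductSpace ComplexConjugate ContinuousMap MatrixGroups
open Filter Set Function TopologicalSpace MeasureTheory

/-! ## 0. Named copies of the crux's `let` gadgets (verbatim; `shadowConverse_iff` is `Iff.rfl`) -/

/-- `K₀(x) = ∫_0^∞ e^{-x cosh t} dt` (the crux's `K0`). -/
def K0 (x : ℝ) : ℝ := ∫ t in Set.Ioi (0 : ℝ), Real.exp (-(x * Real.cosh t))

/-- The Maass lift `φ_(a,ε)(z) = Σ_{n≥1} a_n √y K₀(2πny) (e(nx) + ε e(-nx))` (the crux's `maass`). -/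
def maass (a : ℕ → ℂ) (ε : ℂ) (z : UpperHalfPlane) : ℂ :=
  ∑' n : ℕ, a (n + 1) * ((Real.sqrt z.im * K0 (2 * Real.pi * ((n : ℝ) + 1) * z.im) : ℝ) : ℂ) *
    (Complex.exp (2 * Real.pi * Complex.I * ((n : ℂ) + 1) * (z.re : ℂ)) +
      ε * Complex.exp (-(2 * Real.pi * Complex.I * ((n : ℂ) + 1) * (z.re : ℂ))))

/-- The crux's four-clause cusp-form predicate `IsCusp k L ω g b`. -/
@[folklore] def IsCusp (k L : ℕ) (ω : ℤ → ℂ) (g : UpperHalfPlane → ℂ) (b : ℕ → ℂ) : Prop :=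
  (∀ z : UpperHalfPlane, HasSum (fun m : ℕ => b (m + 1) * Complex.exp (2 * Real.pi * Complex.I * ((m : ℂ) + 1) * (z : ℂ))) (g z)) ∧ MDifferentiable (modelWithCornersSelf ℂ ℂ) (modelWithCornersSelf ℂ ℂ) g ∧ (∀ γ ∈ CongruenceSubgroup.Gamma0 L, ∀ z : UpperHalfPlane, g (γ • z) = ω ((γ : Matrix (Fin 2) (Fin 2) ℤ) 1 1) * ((((γ : Matrix (Fin 2) (Fin 2) ℤ) 1 0 : ℤ) : ℂ) * (z : ℂ) + (((γ : Matrix (Fin 2) (Fin 2) ℤ) 1 1 : ℤ) : ℂ)) ^ k * g z) ∧ ∃ C : ℝ, ∀ z : UpperHalfPlane, z.im ^ ((k : ℝ) / 2) * ‖g z‖ ≤ C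

/-- The crux's `y`-integral `I_k(m,m')`. -/
def Ik (k m m' : ℕ) : ℝ :=
  ∫ y in Set.Ioi (0 : ℝ), y ^ ((k : ℝ) - 3 / 2) * K0 (2 * Real.pi * |(m : ℝ) - (m' : ℝ)| * y) * Real.exp (-(2 * Real.pi * ((m : ℝ) + (m' : ℝ)) * y))

/-- The crux's shifted-convolution summand. -/
def term (a : ℕ → ℂ) (ε : ℂ) (k : ℕ) (b : ℕ → ℂ) (m m' : ℕ) : ℂ :=
  if m' = 0 ∨ m' = m then 0 else (if m' < m then a (m - m') else ε * a (m' - m)) * b m' * ((Ik k m m' : ℝ) : ℂ)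

/-- The crux's shadow coefficient `c_m`. -/
def coeff (a : ℕ → ℂ) (ε : ℂ) (k : ℕ) (b : ℕ → ℂ) (m : ℕ) : ℂ :=
  (((4 * Real.pi * (m : ℝ)) ^ (k - 1) / Real.Gamma ((k : ℝ) - 1) : ℝ) : ℂ) * ∑' m' : ℕ, term a ε k b m m'

/-- The crux's shadow `H = Σ_{m≥1} c_m q^m`. -/
def shadow (a : ℕ → ℂ) (ε : ℂ) (k : ℕ) (b : ℕ → ℂ) (z : UpperHalfPlane) : ℂ :=
  ∑' m : ℕ, coeff a ε k b (m + 1) * Complex.exp (2 * Real.pi * Complex.I * ((m : ℂ) + 1) * (z : ℂ))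

/-- The crux's `ShadowInS`. -/
@[folklore] def ShadowInS (a : ℕ → ℂ) (ε : ℂ) (k : ℕ) (b : ℕ → ℂ) (L : ℕ) (ω : ℤ → ℂ) : Prop :=
  (∀ m : ℕ, Summable (term a ε k b m)) ∧ IsCusp k L ω (shadow a ε k b) (coeff a ε k b)

/-- The crux unfolded over the named gadgets (definitional). -/
theorem shadowConverse_iff : ShadowConverse ↔
    ∀ (N L : ℕ) (χ : DirichletCharacter ℂ N) (ψ : DirichletCharacter ℂ L) (ε : ℂ) (a : ℕ → ℂ) (k₀ : ℕ),
      0 < N → N ∣ L → 0 < L → (ε = 1 ∨ ε = -1) → (∃ C A : ℝ, ∀ n : ℕ, ‖a n‖ ≤ C * ((n : ℝ) + 1) ^ A) →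
      (∀ k : ℕ, k₀ ≤ k → ∀ (b : ℕ → ℂ) (g : UpperHalfPlane → ℂ),
        IsCusp k L (fun d : ℤ => ψ (d : ZMod L)) g b →
          ShadowInS a ε k b L (fun d : ℤ => χ (d : ZMod N) * ψ (d : ZMod L))) →
      ∀ γ ∈ CongruenceSubgroup.Gamma0 L, ∀ z : UpperHalfPlane,
        maass a ε (γ • z) = χ ((((γ : Matrix (Fin 2) (Fin 2) ℤ) 1 1 : ℤ) : ZMod N)) * maass a ε z :=
  Iff.rfl

/-! ## 1. The line's objects: automorphy factor, Bergman kernel/projection on `ℍ`, Poincaré kernel,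
Berezin transform, moderate growth, free points -/

/-- The automorphy factor `J(γ, z) = c z + d`, written exactly as in the crux's `IsCusp`
(`= UpperHalfPlane.denom ↑γ z` by `ModularGroup.denom_apply`, `rfl`). -/
def J (γ : SL(2, ℤ)) (z : UpperHalfPlane) : ℂ :=
  (((γ : Matrix (Fin 2) (Fin 2) ℤ) 1 0 : ℤ) : ℂ) * (z : ℂ) + (((γ : Matrix (Fin 2) (Fin 2) ℤ) 1 1 : ℤ) : ℂ)

/-- The weight-`k` BERGMAN KERNEL of `ℍ` for the measure `(Im w)^k dμ(w)`, `dμ = du dv / v²`: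
`K_k(z, w) = (k-1)/(4π) · ((z - w̄)/(2i))^{-k}`; `K_k(z,z) = (k-1)/(4π) y^{-k}`,
`|K_k(z,w)|² (yv)^k = ((k-1)/4π)² cosh(d(z,w)/2)^{-2k}`. -/
def bergmanKernel (k : ℕ) (z w : UpperHalfPlane) : ℂ :=
  ((((k : ℝ) - 1) / (4 * Real.pi) : ℝ) : ℂ) * ((((z : ℂ) - conj (w : ℂ)) / (2 * Complex.I)) ^ k)⁻¹

/-- The weight-`k` BERGMAN PROJECTION on `ℍ`: `P_k F(z) = ∫_ℍ K_k(z,w) F(w) (Im w)^k dμ(w)` (Bochner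
integral for Mathlib's hyperbolic `volume` on `ℍ`). -/
def bergmanProj (k : ℕ) (F : UpperHalfPlane → ℂ) (z : UpperHalfPlane) : ℂ :=
  ∫ w : UpperHalfPlane, bergmanKernel k z w * F w * ((w.im : ℝ) : ℂ) ^ k

/-- Absolute convergence of the Bergman projection of `F` at every point. -/
@[folklore] def BergmanIntegrable (k : ℕ) (F : UpperHalfPlane → ℂ) : Prop :=
  ∀ z : UpperHalfPlane, Integrable (fun w : UpperHalfPlane => bergmanKernel k z w * F w * ((w.im : ℝ) : ℂ) ^ k)

/-- The POINCARÉ SERIES OF THE BERGMAN KERNEL over `Γ₀(L)` with character `ψ`: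
`G_{k,z}(w) = Σ_{γ ∈ Γ₀(L)} ψ(d_γ)⁻¹ J(γ,w)^{-k} K_k(γw, z)` — for `k` large the reproducing kernel of
`S_k(Γ₀(L), ψ)` at `z` up to normalisation (`≡ 0` when `ψ(-1) ≠ (-1)^k`). -/
def poincareKernel (k L : ℕ) (ψ : DirichletCharacter ℂ L) (z w : UpperHalfPlane) : ℂ :=
  ∑' γ : CongruenceSubgroup.Gamma0 L,
    (ψ ((((γ : SL(2, ℤ)) : Matrix (Fin 2) (Fin 2) ℤ) 1 1 : ℤ) : ZMod L))⁻¹ *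
      (J (γ : SL(2, ℤ)) w ^ k)⁻¹ * bergmanKernel k ((γ : SL(2, ℤ)) • w) z

/-- The BEREZIN TRANSFORM at level `k` — verbatim the expression inside the route's support item
`BerezinLocalization` (`berezinLocalization_iff` is `Iff.rfl`). -/
def berezin (k : ℕ) (φ : UpperHalfPlane → ℂ) (z₀ : UpperHalfPlane) : ℂ :=
  ((((k : ℝ) - 1) / (4 * Real.pi) : ℝ) : ℂ) *
    ∫ z : UpperHalfPlane, (((Real.cosh (dist z z₀ / 2)) ^ (-(2 * (k : ℝ))) : ℝ) : ℂ) * φ z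

/-- The route's support item `BerezinLocalization` (stmt-Langlands-11635) over `berezin` (definitional). -/
theorem berezinLocalization_iff : BerezinLocalization ↔
    ∀ (φ : UpperHalfPlane → ℂ) (C A : ℝ), Continuous φ →
      (∀ z : UpperHalfPlane, ‖φ z‖ ≤ C * (z.im ^ A + z.im ^ (-A))) →
        ∀ z₀ : UpperHalfPlane, Filter.Tendsto (fun k : ℕ => berezin k φ z₀) Filter.atTop (nhds (φ z₀)) :=
  Iff.rfl

/-- MODERATE GROWTH with constants `(C, A)`: `‖φ(z)‖ ≤ C cosh(d(z, i))^A` — polynomial growth in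
`(1 + x² + y²)/y = 2 cosh d(z,i)`, the `SL₂(ℝ)`-stable growth class containing the Maass lift AND all its
translates `φ ∘ γ` (unlike the periodic class `y^A + y^{-A}`). -/
@[folklore] def ModerateGrowth (φ : UpperHalfPlane → ℂ) (C A : ℝ) : Prop :=
  ∀ z : UpperHalfPlane, ‖φ z‖ ≤ C * Real.cosh (dist z UpperHalfPlane.I) ^ A

/-- FREE POINT of `Γ₀(L)` (verbatim line `birth`): every element of `Γ₀(L)` fixing `z` acts trivially. -/
@[folklore] def IsFreePoint (L : ℕ) (z : UpperHalfPlane) : Prop :=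
  ∀ γ ∈ CongruenceSubgroup.Gamma0 L, γ • z = z → ∀ w : UpperHalfPlane, γ • w = w

/-! ## 2. The stubs (the ONLY sorries of this file) -/

/-- **STUB 1 — the Maass lift is continuous of moderate growth, stably under `SL₂(ℤ)`** (M; true
analysis). For `‖a_n‖ ≤ C(n+1)^A` and any `ε`: `φ_(a,ε)` is continuous, and there is ONE exponent
`A' ≥ 0` such that for every `γ ∈ SL₂(ℤ)`, `‖φ(γz)‖ ≤ C_γ cosh(d(z,i))^{A'}`. Proof route:
`0 ≤ K₀(x) ≤ e^{-x}√(π/2x)` gives `‖φ(w)‖ ≤ C₁ (v^{A+1} + v^{-A-1})`, locally uniform convergence gives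
continuity; `v + v⁻¹ ≤ 2 cosh d(w,i)` and `cosh d(γz, i) = cosh d(z, γ⁻¹ i) ≤ 2 cosh d(z,i) cosh d(i, γ⁻¹i)`
(isometric action, `cosh(a+b) ≤ 2 cosh a cosh b`). [cite: Iwaniec2002, §1.1–1.2 and Thm 3.1] -/
theorem stub_maassLiftModerateGrowth (a : ℕ → ℂ) (ε : ℂ) (C A : ℝ)
    (ha : ∀ n : ℕ, ‖a n‖ ≤ C * ((n : ℝ) + 1) ^ A) :
    Continuous (maass a ε) ∧ ∃ A' : ℝ, 0 ≤ A' ∧ ∀ γ : SL(2, ℤ), ∃ C' : ℝ,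
      ModerateGrowth (fun z : UpperHalfPlane => maass a ε (γ • z)) C' A' := by
  sorry

/-- **STUB 2 — the typed shadow IS the weight-`k` Bergman projection of `φ·g` on `ℍ`** (L; true
analysis — Sturm's coefficient formula read through Lipschitz). For `‖a_n‖ ≤ C(n+1)^A` there is
`k₁ = k₁(A)` such that for all `k ≥ k₁` and every `g = Σ b_m q^m` of the four-clause class (any level,
any multiplier; only the `q`-expansion and the bound `y^{k/2}|g| ≤ C_g` are used): the integrals
`∫_ℍ K_k(z,w) φ(w) g(w) v^k dμ(w)` converge absolutely and `shadow a ε k b = P_k(φ_(a,ε) g)` as functions on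
`ℍ`. Proof route: `coeff m = κ_m ⟨φ g, e_m⟩_strip` (orthogonality of `e(nx)` on `[0,1]`, the `y`-integral
is the typed `Ik`), `κ_m = (4πm)^{k-1}/Γ(k-1)`; Lipschitz `Σ_n K_k(z, w+n) = Σ_{m≥1} κ_m e(mz) e(-m w̄)`
(from `Σ_n (τ+n)^{-k} = (-2πi)^k/(k-1)! Σ m^{k-1} e(mτ)` = Mathlib's `EisensteinSeries.qExpansion_identity`
applied at `τ = z - w̄ ∈ ℍ`, and `(2i)(-2πi) = 4π`); unfolding `ℍ = ⊔_n (strip + n)` by `1`-periodicity of `φ g`;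
Fubini for `k > 2A + 6`. [cite: Sturm1980, Thm 1] [cite: GrossZagier1986, §IV.5] -/
theorem stub_shadow_eq_bergmanProj (a : ℕ → ℂ) (ε : ℂ) (C A : ℝ)
    (ha : ∀ n : ℕ, ‖a n‖ ≤ C * ((n : ℝ) + 1) ^ A) :
    ∃ k₁ : ℕ, ∀ (k L : ℕ) (ω : ℤ → ℂ) (b : ℕ → ℂ) (g : UpperHalfPlane → ℂ), k₁ ≤ k →
      IsCusp k L ω g b →
        BergmanIntegrable k (fun w : UpperHalfPlane => maass a ε w * g w) ∧
          shadow a ε k b = bergmanProj k (fun w : UpperHalfPlane => maass a ε w * g w) := by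
  sorry

/-- **STUB 3 — `SL₂`-equivariance of the Bergman projection** (M; exact change of variables). For
`γ ∈ SL₂(ℤ)` and `F` with absolutely convergent projection: the weight-`k` translate
`w ↦ F(γw) J(γ,w)^{-k}` again has absolutely convergent projection, and
`P_k(F∘γ · J_γ^{-k})(z) = J(γ,z)^{-k} (P_k F)(γz)`. Ingredients: `μ` is `SL₂(ℝ)`-invariant
(`SMulInvariantMeasure`, `integral_smul_eq_self`), `Im(γw) = v/|J(γ,w)|²`, the Bergman cocycle
`(γz - conj(γw)) = (z - w̄)/(J(γ,z) conj J(γ,w))`, and `J(γ, γ⁻¹w) J(γ⁻¹, w) = 1`. [cite: Radulescu1998, Introduction] -/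
theorem stub_bergmanProj_slash (k : ℕ) (γ : SL(2, ℤ)) (F : UpperHalfPlane → ℂ)
    (hF : BergmanIntegrable k F) :
    BergmanIntegrable k (fun w : UpperHalfPlane => F (γ • w) * (J γ w ^ k)⁻¹) ∧
      ∀ z : UpperHalfPlane,
        bergmanProj k (fun w : UpperHalfPlane => F (γ • w) * (J γ w ^ k)⁻¹) z =
          (J γ z ^ k)⁻¹ * bergmanProj k F (γ • z) := by
  sorry

/-- **STUB 4 — test vectors: the Poincaré series of the Bergman kernel is a cusp form** (L;
Petersson's theory, typed in the four-clause sense). For `0 < L` and `ψ mod L` there is `k₂` such that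
for all `k ≥ k₂` and all `z ∈ ℍ`, `G_{k,z} = poincareKernel k L ψ z` has a `q`-expansion `Σ_{m≥1} b_m q^m`,
is holomorphic, satisfies `G(βw) = ψ(d_β) J(β,w)^k G(w)` on `Γ₀(L)` and `v^{k/2}|G|` is bounded
(when `ψ(-1) ≠ (-1)^k` it is `≡ 0`, with `b = 0`). Ingredients: absolute/locally uniform convergence from
`|J(γ,w)^{-k} K_k(γw,z)| = (k-1)/(4π) (v y)^{-k/2} cosh(d(w, γ⁻¹z)/2)^{-k}` and crude orbit counting
`#{γ ∈ SL₂(ℤ) : d(z, γz) ≤ R} ≤ C_z e^{2R}` (`four_mul_pointPairInv_smul_I_add_two`); reindexing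
`γ ↦ γβ`; `q`-expansion of a `1`-periodic holomorphic function that is `O(v^{-k/2})`; decay at the cusps of
`Γ₀(L)` (bounded height of the orbit `Γ₀(L) z`). [cite: Iwaniec2002, §3.1–3.2] [cite: DiamondShurman2005, §5.7] -/
theorem stub_poincareKernel_isCusp (L : ℕ) (hL : 0 < L) (ψ : DirichletCharacter ℂ L) :
    ∃ k₂ : ℕ, ∀ k : ℕ, k₂ ≤ k → ∀ z : UpperHalfPlane, ∃ b : ℕ → ℂ,
      IsCusp k L (fun d : ℤ => ψ (d : ZMod L)) (poincareKernel k L ψ z) b := by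
  sorry

/-- **STUB 5 — THE HEART: off-diagonal decay at free points** (L; the line's one genuine estimate,
hypothesis-free). For continuous `D` of moderate growth, `0 < L`, `ψ(-1) = (-1)^r` and a FREE point `z`:
along `k = 2j + r → ∞`,  `P_k(D · G_{k,z})(z) / (2 K_k(z,z)) − B_k D(z) → 0`.
Proof route: for `k` large insert the absolutely convergent series `G_{k,z}` and interchange (Tonelli);
the terms `γ = ±1` (the whole stabiliser of a free point; `ψ(±1)⁻¹ J(±1,w)^{-k} = 1` in the parity class)
each give `∫ |K_k(z,w)|² D v^k dμ = K_k(z,z) · B_k D(z)`; every other term is bounded through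
`|K_k(z,w)| |J(γ,w)|^{-k} |K_k(γw,z)| v^k = ((k-1)/4π)² y^{-k} cosh(d(z,w)/2)^{-k} cosh(d(w,γ⁻¹z)/2)^{-k}` and
`cosh(a/2)cosh(b/2) ≥ cosh²((a+b)/4) ≥ cosh(d(z,γ⁻¹z)/4)·cosh(d(z,w)/4)` by
`cosh(d(z,γ⁻¹z)/4)^{-k} · ∫ cosh(d(z,w)/4)^{-k} |D(w)| dμ(w)` (finite and DECREASING in `k` once
`k > 4A + 4`); with `d_min(z) = min_{γ ≠ ±1} d(z, γz) > 0` (discreteness + freeness) and crude orbit counting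
`#{γ : d(z,γz) ≤ R} ≤ C_z e^{2R}` the off-diagonal total over `2K_k(z,z)` is `≤ C'_z (k-1) cosh(d_min/4)^{-(k-k₃)} → 0`.
Why it might fail: only through a slip in the normalisations above (the estimate is pointwise in `z`; no
uniformity in `z` is claimed — the Auvray–Ma–Marinescu caveat of the route concerns `y ≳ √k` uniformity).
[cite: Radulescu1998, Introduction pp. 8, 19] [cite: Iwaniec2002, §1.1 and (12.10)–(12.11)] -/
theorem stub_offDiagonalDecay (L : ℕ) (hL : 0 < L) (ψ : DirichletCharacter ℂ L) (r : ℕ)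
    (hr : ψ (-1) = (-1 : ℂ) ^ r) (D : UpperHalfPlane → ℂ) (C A : ℝ) (hD : Continuous D)
    (hDg : ModerateGrowth D C A) (z : UpperHalfPlane) (hz : IsFreePoint L z) :
    Filter.Tendsto (fun j : ℕ =>
        bergmanProj (2 * j + r) (fun w : UpperHalfPlane => D w * poincareKernel (2 * j + r) L ψ z w) z /
            (2 * bergmanKernel (2 * j + r) z z) -
          berezin (2 * j + r) D z) Filter.atTop (nhds 0) := by
  sorry

/-- **STUB 6 — Berezin localisation for moderate growth** (L; provable now, a strengthening of the
route's support item `BerezinLocalization` = the periodic-growth case, see `berezinLocalization_of`):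
for continuous `D` with `‖D(w)‖ ≤ C cosh(d(w,i))^A`, `B_k D(z₀) → D(z₀)` as `k → ∞`. Ingredients: the
kernel `(k-1)/(4π) cosh(d/2)^{-2k} dμ` is a probability measure (`μ(B(z₀,ρ)) = 4π sinh²(ρ/2)`), it
concentrates at rate `k^{-1/2}`, and its tail beats `cosh(d)^A sinh d` once `k > A + 1`; continuity of `D`
at `z₀`. [cite: Radulescu1998, Introduction] [cite: Iwaniec2002, (1.3)–(1.4)] -/
theorem stub_berezinLocalization_moderate (D : UpperHalfPlane → ℂ) (C A : ℝ) (hD : Continuous D)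
    (hDg : ModerateGrowth D C A) (z₀ : UpperHalfPlane) :
    Filter.Tendsto (fun k : ℕ => berezin k D z₀) Filter.atTop (nhds (D z₀)) := by
  sorry

/-- **STUB 7 — free points are dense** (M; verbatim the statement of line `birth`): each of the
countably many `γ ≠ ±1` fixes at most one point of `ℍ` (`UpperHalfPlane.gl_smul_eq_self_iff_eq_fixedPt`,
`forall_smul_eq_self_iff_mem_center`), and the complement of a countable subset of `ℍ` is dense.
[cite: Iwaniec2002, §2.3] -/
theorem stub_freePointsDense (L : ℕ) : Dense {z : UpperHalfPlane | IsFreePoint L z} := by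
  sorry

/-! ## 3. The stub statements as named propositions -/

namespace _Goal

/-- The statement of `stub_maassLiftModerateGrowth` (literally its type). -/
@[folklore] def stub_maassLiftModerateGrowth : Prop :=
  type_of% @Summit.Langlands.Langlands.Cruxes.ShadowConverse.Defect.stub_maassLiftModerateGrowth

/-- The statement of `stub_shadow_eq_bergmanProj` (literally its type). -/
@[folklore] def stub_shadow_eq_bergmanProj : Prop :=
  type_of% @Summit.Langlands.Langlands.Cruxes.ShadowConverse.Defect.stub_shadow_eq_bergmanProj

/-- The statement of `stub_bergmanProj_slash` (literally its type). -/
@[folklore] def stub_bergmanProj_slash : Prop :=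
  type_of% @Summit.Langlands.Langlands.Cruxes.ShadowConverse.Defect.stub_bergmanProj_slash

/-- The statement of `stub_poincareKernel_isCusp` (literally its type). -/
@[folklore] def stub_poincareKernel_isCusp : Prop :=
  type_of% @Summit.Langlands.Langlands.Cruxes.ShadowConverse.Defect.stub_poincareKernel_isCusp

/-- The statement of `stub_offDiagonalDecay` (literally its type). -/
@[folklore] def stub_offDiagonalDecay : Prop :=
  type_of% @Summit.Langlands.Langlands.Cruxes.ShadowConverse.Defect.stub_offDiagonalDecay

/-- The statement of `stub_berezinLocalization_moderate` (literally its type). -/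
@[folklore] def stub_berezinLocalization_moderate : Prop :=
  type_of% @Summit.Langlands.Langlands.Cruxes.ShadowConverse.Defect.stub_berezinLocalization_moderate

/-- The statement of `stub_freePointsDense` (literally its type). -/
@[folklore] def stub_freePointsDense : Prop :=
  type_of% @Summit.Langlands.Langlands.Cruxes.ShadowConverse.Defect.stub_freePointsDense

end _Goal

/-! ## 4. Sorry-free glue -/

/-- `J(γ, z) ≠ 0` (it is Mathlib's `denom`). -/
theorem J_ne_zero (γ : SL(2, ℤ)) (z : UpperHalfPlane) : J γ z ≠ 0 := by
  have h := UpperHalfPlane.denom_ne_zero (γ : GL (Fin 2) ℝ) z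
  rw [ModularGroup.denom_apply] at h
  simpa [J] using h

/-- For `γ ∈ Γ₀(L)` the lower-right entry is a unit mod `L` (`ad ≡ 1`). -/
theorem isUnit_d_of_mem_Gamma0 {L : ℕ} {γ : SL(2, ℤ)} (hγ : γ ∈ CongruenceSubgroup.Gamma0 L) :
    IsUnit ((((γ : Matrix (Fin 2) (Fin 2) ℤ) 1 1 : ℤ) : ZMod L)) := by
  have hc : (((γ : Matrix (Fin 2) (Fin 2) ℤ) 1 0 : ℤ) : ZMod L) = 0 := CongruenceSubgroup.Gamma0_mem.mp hγ
  have hdet : (γ : Matrix (Fin 2) (Fin 2) ℤ).det = 1 := Matrix.SpecialLinearGroup.det_coe γ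
  rw [Matrix.det_fin_two] at hdet
  have h' : (((γ : Matrix (Fin 2) (Fin 2) ℤ) 0 0 : ℤ) : ZMod L) * (((γ : Matrix (Fin 2) (Fin 2) ℤ) 1 1 : ℤ) : ZMod L)
      - (((γ : Matrix (Fin 2) (Fin 2) ℤ) 0 1 : ℤ) : ZMod L) * (((γ : Matrix (Fin 2) (Fin 2) ℤ) 1 0 : ℤ) : ZMod L) = 1 := by
    exact_mod_cast congrArg (fun t : ℤ => (t : ZMod L)) hdet
  rw [hc, mul_zero, sub_zero] at h'
  exact IsUnit.of_mul_eq_one_right _ h'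

/-- `ψ(-1) = (-1)^r` for `r = 0` or `r = 1`. -/
theorem exists_parity {L : ℕ} (ψ : DirichletCharacter ℂ L) : ∃ r : ℕ, ψ (-1) = (-1 : ℂ) ^ r := by
  rcases ψ.even_or_odd with h | h
  · exact ⟨0, by rw [pow_zero]; exact h⟩
  · exact ⟨1, by rw [pow_one]; exact h⟩


/-- `cosh d(z, i) = (x² + y² + 1)/(2y)`. -/
theorem cosh_dist_I (z : UpperHalfPlane) :
    Real.cosh (dist z UpperHalfPlane.I) = (z.re ^ 2 + z.im ^ 2 + 1) / (2 * z.im) := by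
  rw [UpperHalfPlane.cosh_dist]
  have hd : dist (z : ℂ) (UpperHalfPlane.I : ℂ) ^ 2 = z.re ^ 2 + (z.im - 1) ^ 2 := by
    rw [Complex.dist_eq, Complex.sq_norm, Complex.normSq_apply]
    simp [UpperHalfPlane.I]
    ring
  rw [hd, UpperHalfPlane.I_im]
  have hy : (0 : ℝ) < z.im := z.im_pos
  field_simp
  ring

/-- `2 cosh d(z, i) = (x² + y² + 1)/y`. -/
theorem two_cosh_dist_I (z : UpperHalfPlane) :
    2 * Real.cosh (dist z UpperHalfPlane.I) = (z.re ^ 2 + z.im ^ 2 + 1) / z.im := by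
  rw [cosh_dist_I]
  have hy : (0 : ℝ) < z.im := z.im_pos
  field_simp

/-- `y ≤ 2 cosh d(z, i)`. -/
theorem im_le_two_cosh (z : UpperHalfPlane) : z.im ≤ 2 * Real.cosh (dist z UpperHalfPlane.I) := by
  rw [two_cosh_dist_I, le_div_iff₀ z.im_pos]
  nlinarith [sq_nonneg z.re]

/-- `y⁻¹ ≤ 2 cosh d(z, i)`. -/
theorem inv_im_le_two_cosh (z : UpperHalfPlane) : z.im⁻¹ ≤ 2 * Real.cosh (dist z UpperHalfPlane.I) := by
  rw [two_cosh_dist_I, inv_eq_one_div, div_le_div_iff_of_pos_right z.im_pos]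
  nlinarith [sq_nonneg z.re, sq_nonneg z.im]

/-- The periodic growth class sits inside the moderate one: `y^A + y^{-A} ≤ 2 (2 cosh d(z,i))^{|A|}`. -/
theorem rpow_add_rpow_neg_le (z : UpperHalfPlane) (A : ℝ) :
    z.im ^ A + z.im ^ (-A) ≤ 2 * (2 * Real.cosh (dist z UpperHalfPlane.I)) ^ |A| := by
  have hy : (0 : ℝ) < z.im := z.im_pos
  have h1 := im_le_two_cosh z
  have h2 := inv_im_le_two_cosh z
  have key : ∀ B : ℝ, 0 ≤ B → z.im ^ B ≤ (2 * Real.cosh (dist z UpperHalfPlane.I)) ^ B ∧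
      z.im ^ (-B) ≤ (2 * Real.cosh (dist z UpperHalfPlane.I)) ^ B := by
    intro B hB
    refine ⟨Real.rpow_le_rpow hy.le h1 hB, ?_⟩
    rw [Real.rpow_neg hy.le, ← Real.inv_rpow hy.le]
    exact Real.rpow_le_rpow (inv_nonneg.mpr hy.le) h2 hB
  rcases le_or_gt 0 A with hA | hA
  · rw [abs_of_nonneg hA]
    obtain ⟨k1, k2⟩ := key A hA
    linarith
  · rw [abs_of_neg hA]
    obtain ⟨k1, k2⟩ := key (-A) (by linarith)
    rw [neg_neg] at k2
    linarith

/-- A periodic-growth bound `‖φ‖ ≤ C (y^A + y^{-A})` is a moderate-growth bound with exponent `|A|`. -/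
theorem moderateGrowth_of_periodicGrowth (φ : UpperHalfPlane → ℂ) (C A : ℝ)
    (h : ∀ z : UpperHalfPlane, ‖φ z‖ ≤ C * (z.im ^ A + z.im ^ (-A))) :
    ModerateGrowth φ (max C 0 * 2 * (2 : ℝ) ^ |A|) |A| := by
  intro z
  have hS : 0 < z.im ^ A + z.im ^ (-A) := by
    have := Real.rpow_pos_of_pos z.im_pos A
    have := Real.rpow_pos_of_pos z.im_pos (-A)
    linarith
  have hc : 0 < Real.cosh (dist z UpperHalfPlane.I) := Real.cosh_pos _
  calc ‖φ z‖ ≤ C * (z.im ^ A + z.im ^ (-A)) := h z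
    _ ≤ max C 0 * (z.im ^ A + z.im ^ (-A)) := mul_le_mul_of_nonneg_right (le_max_left _ _) hS.le
    _ ≤ max C 0 * (2 * (2 * Real.cosh (dist z UpperHalfPlane.I)) ^ |A|) :=
        mul_le_mul_of_nonneg_left (rpow_add_rpow_neg_le z A) (le_max_right _ _)
    _ = (max C 0 * 2 * (2 : ℝ) ^ |A|) * Real.cosh (dist z UpperHalfPlane.I) ^ |A| := by
        rw [Real.mul_rpow (by norm_num) hc.le]
        ring

/-- **STUB 6 closes the route's support item.** `BerezinLocalization` (stmt-Langlands-11635) is the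
periodic-growth case of `stub_berezinLocalization_moderate`; a prover landing STUB 6 lands the support
item with this three-line corollary. -/
theorem berezinLocalization_of (h₆ : _Goal.stub_berezinLocalization_moderate) : BerezinLocalization := by
  have H₆ : ∀ (D : UpperHalfPlane → ℂ) (C A : ℝ), Continuous D → ModerateGrowth D C A →
      ∀ z₀ : UpperHalfPlane, Filter.Tendsto (fun k : ℕ => berezin k D z₀) Filter.atTop (nhds (D z₀)) := h₆
  rw [berezinLocalization_iff]
  intro φ C A hφ hgr z₀
  exact H₆ φ _ _ hφ (moderateGrowth_of_periodicGrowth φ C A hgr) z₀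

/-! ## 5. Composition (kernel-checked, no `sorry`): STUBS 1–7 ⟹ `ShadowConverse` BY NAME -/

/-- **`ShadowConverse` from the seven stubs.** Fix the data of the crux, `γ ∈ Γ₀(L)`, and put
`φ = φ_(a,ε)`, `ψd = ψ(d_γ) ≠ 0`, `χd = χ(d_γ)`, `δ(w) = ψd φ(γw) - χd ψd φ(w)` (the defect, continuous of
moderate growth by STUB 1). For `k ≥ max(k₀,k₁,k₂)` and any `z'`, STUB 4 supplies the cusp form
`G = G_{k,z'} ∈ S_k(Γ₀(L),ψ)`; the crux hypothesis makes the typed shadow of `(a,ε,G)` modular of character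
`χψ`; STUB 2 identifies that shadow with `P_k(φ G)`; STUB 3 (equivariance) and the modularity of `G` turn
`shadow(γz'') = χψ(d) J^k shadow(z'')` into `P_k(ψd·φ∘γ·G) = χd ψd P_k(φ G)`, i.e. `P_k(δ G_{k,z'}) ≡ 0`.
At a free `w`, STUB 5 along `k = 2j + r` (`ψ(-1) = (-1)^r`) then says `B_k δ(w) → 0`, STUB 6 says
`B_k δ(w) → δ(w)`, so `δ(w) = 0`; STUB 7 + continuity give `δ ≡ 0`, and `ψd ≠ 0` gives
`φ(γz) = χd φ(z)`. -/
theorem ShadowConverse_of (h₁ : _Goal.stub_maassLiftModerateGrowth) (h₂ : _Goal.stub_shadow_eq_bergmanProj)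
    (h₃ : _Goal.stub_bergmanProj_slash) (h₄ : _Goal.stub_poincareKernel_isCusp)
    (h₅ : _Goal.stub_offDiagonalDecay) (h₆ : _Goal.stub_berezinLocalization_moderate)
    (h₇ : _Goal.stub_freePointsDense) : ShadowConverse := by
  have H₁ : ∀ (a : ℕ → ℂ) (ε : ℂ) (C A : ℝ), (∀ n : ℕ, ‖a n‖ ≤ C * ((n : ℝ) + 1) ^ A) →
      Continuous (maass a ε) ∧ ∃ A' : ℝ, 0 ≤ A' ∧ ∀ γ : SL(2, ℤ), ∃ C' : ℝ,
        ModerateGrowth (fun z : UpperHalfPlane => maass a ε (γ • z)) C' A' := h₁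
  have H₂ : ∀ (a : ℕ → ℂ) (ε : ℂ) (C A : ℝ), (∀ n : ℕ, ‖a n‖ ≤ C * ((n : ℝ) + 1) ^ A) →
      ∃ k₁ : ℕ, ∀ (k L : ℕ) (ω : ℤ → ℂ) (b : ℕ → ℂ) (g : UpperHalfPlane → ℂ), k₁ ≤ k →
        IsCusp k L ω g b →
          BergmanIntegrable k (fun w : UpperHalfPlane => maass a ε w * g w) ∧
            shadow a ε k b = bergmanProj k (fun w : UpperHalfPlane => maass a ε w * g w) := h₂
  have H₃ : ∀ (k : ℕ) (γ : SL(2, ℤ)) (F : UpperHalfPlane → ℂ), BergmanIntegrable k F →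
      BergmanIntegrable k (fun w : UpperHalfPlane => F (γ • w) * (J γ w ^ k)⁻¹) ∧
        ∀ z : UpperHalfPlane,
          bergmanProj k (fun w : UpperHalfPlane => F (γ • w) * (J γ w ^ k)⁻¹) z =
            (J γ z ^ k)⁻¹ * bergmanProj k F (γ • z) := h₃
  have H₄ : ∀ (L : ℕ), 0 < L → ∀ ψ : DirichletCharacter ℂ L,
      ∃ k₂ : ℕ, ∀ k : ℕ, k₂ ≤ k → ∀ z : UpperHalfPlane, ∃ b : ℕ → ℂ,
        IsCusp k L (fun d : ℤ => ψ (d : ZMod L)) (poincareKernel k L ψ z) b := h₄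
  have H₅ : ∀ (L : ℕ), 0 < L → ∀ (ψ : DirichletCharacter ℂ L) (r : ℕ), ψ (-1) = (-1 : ℂ) ^ r →
      ∀ (D : UpperHalfPlane → ℂ) (C A : ℝ), Continuous D → ModerateGrowth D C A →
        ∀ z : UpperHalfPlane, IsFreePoint L z →
          Filter.Tendsto (fun j : ℕ =>
            bergmanProj (2 * j + r) (fun w : UpperHalfPlane => D w * poincareKernel (2 * j + r) L ψ z w) z /
                (2 * bergmanKernel (2 * j + r) z z) -
              berezin (2 * j + r) D z) Filter.atTop (nhds 0) := h₅
  have H₆ : ∀ (D : UpperHalfPlane → ℂ) (C A : ℝ), Continuous D → ModerateGrowth D C A →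
      ∀ z₀ : UpperHalfPlane, Filter.Tendsto (fun k : ℕ => berezin k D z₀) Filter.atTop (nhds (D z₀)) := h₆
  have H₇ : ∀ L : ℕ, Dense {z : UpperHalfPlane | IsFreePoint L z} := h₇
  rw [shadowConverse_iff]
  intro N L χ ψ ε a k₀ _hN _hNL hL _hε hgrowth hshadow γ hγ z
  obtain ⟨C, A, ha⟩ := hgrowth
  -- STUB 1: continuity and moderate growth of all translates
  obtain ⟨hcont, A', _hA', hgr⟩ := H₁ a ε C A ha
  -- STUB 2 and STUB 4 thresholds
  obtain ⟨k₁, hk₁⟩ := H₂ a ε C A ha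
  obtain ⟨k₂, hk₂⟩ := H₄ L hL ψ
  -- parity class of ψ
  obtain ⟨r, hr⟩ := exists_parity ψ
  -- abbreviations
  set φ : UpperHalfPlane → ℂ := maass a ε with hφ
  set χd : ℂ := χ ((((γ : Matrix (Fin 2) (Fin 2) ℤ) 1 1 : ℤ) : ZMod N)) with hχd
  set ψd : ℂ := ψ ((((γ : Matrix (Fin 2) (Fin 2) ℤ) 1 1 : ℤ) : ZMod L)) with hψd
  have hψd0 : ψd ≠ 0 := MulChar.apply_ne_zero_iff.mpr (isUnit_d_of_mem_Gamma0 hγ)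
  -- the defect
  set δ : UpperHalfPlane → ℂ := fun w => ψd * φ (γ • w) - χd * ψd * φ w with hδ
  have hγc : Continuous fun w : UpperHalfPlane => γ • w := by
    simp only [ModularGroup.sl_moeb]
    exact continuous_const_smul _
  have hδc : Continuous δ :=
    (continuous_const.mul (hcont.comp hγc)).sub (continuous_const.mul hcont)
  obtain ⟨C₁, hC₁⟩ := hgr γ
  obtain ⟨C₀, hC₀⟩ := hgr 1
  have hδg : ModerateGrowth δ (‖ψd‖ * C₁ + ‖χd * ψd‖ * C₀) A' := by
    intro w
    have e1 : ‖φ (γ • w)‖ ≤ C₁ * Real.cosh (dist w UpperHalfPlane.I) ^ A' := hC₁ w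
    have e0 : ‖φ w‖ ≤ C₀ * Real.cosh (dist w UpperHalfPlane.I) ^ A' := by
      simpa only [one_smul] using hC₀ w
    calc ‖δ w‖ = ‖ψd * φ (γ • w) - χd * ψd * φ w‖ := rfl
      _ ≤ ‖ψd * φ (γ • w)‖ + ‖χd * ψd * φ w‖ := norm_sub_le _ _
      _ = ‖ψd‖ * ‖φ (γ • w)‖ + ‖χd * ψd‖ * ‖φ w‖ := by rw [norm_mul, norm_mul]
      _ ≤ ‖ψd‖ * (C₁ * Real.cosh (dist w UpperHalfPlane.I) ^ A') +
            ‖χd * ψd‖ * (C₀ * Real.cosh (dist w UpperHalfPlane.I) ^ A') :=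
          add_le_add (mul_le_mul_of_nonneg_left e1 (norm_nonneg _))
            (mul_le_mul_of_nonneg_left e0 (norm_nonneg _))
      _ = (‖ψd‖ * C₁ + ‖χd * ψd‖ * C₀) * Real.cosh (dist w UpperHalfPlane.I) ^ A' := by ring
  -- THE ALGEBRAIC CORE: the Toeplitz compressions of δ vanish on S_k(Γ₀(L), ψ)-test vectors G_{k,z'}
  have hvan : ∀ k : ℕ, k₀ ≤ k → k₁ ≤ k → k₂ ≤ k → ∀ z' z'' : UpperHalfPlane,
      bergmanProj k (fun w : UpperHalfPlane => δ w * poincareKernel k L ψ z' w) z'' = 0 := by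
    intro k hk0 hk1 hk2 z' z''
    set G : UpperHalfPlane → ℂ := poincareKernel k L ψ z' with hG
    obtain ⟨b, hGcusp⟩ := hk₂ k hk2 z'
    -- the crux hypothesis on the test vector G
    have hSh : ShadowInS a ε k b L (fun d : ℤ => χ (d : ZMod N) * ψ (d : ZMod L)) := hshadow k hk0 b G hGcusp
    have hmodS := hSh.2.2.2.1
    have hmodG := hGcusp.2.2.1
    -- STUB 2: shadow = P_k(φ G)
    obtain ⟨hint, hshadowP⟩ := hk₁ k L _ b G hk1 hGcusp
    -- STUB 3: equivariance for F = φ G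
    obtain ⟨hint', hslash⟩ := H₃ k γ (fun w : UpperHalfPlane => φ w * G w) hint
    -- modularity of G read through J
    have hGγ : ∀ w : UpperHalfPlane, G (γ • w) = ψd * J γ w ^ k * G w := fun w => hmodG γ hγ w
    have hfun : (fun w : UpperHalfPlane => (φ (γ • w) * G (γ • w)) * (J γ w ^ k)⁻¹) =
        fun w : UpperHalfPlane => ψd * φ (γ • w) * G w := by
      funext w
      rw [hGγ w]
      have hJk : J γ w ^ k ≠ 0 := pow_ne_zero _ (J_ne_zero γ w)
      field_simp
    have hint'' : BergmanIntegrable k (fun w : UpperHalfPlane => ψd * φ (γ • w) * G w) := by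
      rw [← hfun]; exact hint'
    have hslash' : ∀ z₁ : UpperHalfPlane, bergmanProj k (fun w : UpperHalfPlane => ψd * φ (γ • w) * G w) z₁ =
        (J γ z₁ ^ k)⁻¹ * bergmanProj k (fun w : UpperHalfPlane => φ w * G w) (γ • z₁) := by
      rw [← hfun]; exact hslash
    -- modularity of the shadow read through P_k(φ G)
    have hPγ : ∀ z₁ : UpperHalfPlane, bergmanProj k (fun w : UpperHalfPlane => φ w * G w) (γ • z₁) =
        χd * ψd * J γ z₁ ^ k * bergmanProj k (fun w : UpperHalfPlane => φ w * G w) z₁ := by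
      intro z₁
      have hm := hmodS γ hγ z₁
      rw [hshadowP] at hm
      exact hm
    have hkey : ∀ z₁ : UpperHalfPlane, bergmanProj k (fun w : UpperHalfPlane => ψd * φ (γ • w) * G w) z₁ =
        χd * ψd * bergmanProj k (fun w : UpperHalfPlane => φ w * G w) z₁ := by
      intro z₁
      rw [hslash' z₁, hPγ z₁]
      have hJk : J γ z₁ ^ k ≠ 0 := pow_ne_zero _ (J_ne_zero γ z₁)
      field_simp
    -- linearity of the Bergman projection
    have hsplit : bergmanProj k (fun w : UpperHalfPlane => δ w * G w) z'' =
        bergmanProj k (fun w : UpperHalfPlane => ψd * φ (γ • w) * G w) z'' -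
          χd * ψd * bergmanProj k (fun w : UpperHalfPlane => φ w * G w) z'' := by
      have e : (fun w : UpperHalfPlane => bergmanKernel k z'' w * (δ w * G w) * ((w.im : ℝ) : ℂ) ^ k) =
          fun w : UpperHalfPlane =>
            bergmanKernel k z'' w * (ψd * φ (γ • w) * G w) * ((w.im : ℝ) : ℂ) ^ k -
              χd * ψd * (bergmanKernel k z'' w * (φ w * G w) * ((w.im : ℝ) : ℂ) ^ k) := by
        funext w
        simp only [hδ]
        ring
      simp only [bergmanProj]
      rw [e, integral_sub (hint'' z'') ((hint z'').const_mul _), integral_const_mul]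
    rw [hsplit, hkey z'', sub_self]
  -- at every free point the defect vanishes (STUBS 5, 6)
  have hks : Filter.Tendsto (fun j : ℕ => 2 * j + r) Filter.atTop Filter.atTop :=
    Filter.tendsto_atTop_atTop.mpr fun n => ⟨n, fun j hj => by omega⟩
  have hfree : ∀ w : UpperHalfPlane, IsFreePoint L w → δ w = 0 := by
    intro w hw
    have t5 := H₅ L hL ψ r hr δ _ A' hδc hδg w hw
    have t6 : Filter.Tendsto (fun j : ℕ => berezin (2 * j + r) δ w) Filter.atTop (nhds (δ w)) :=
      (H₆ δ _ A' hδc hδg w).comp hks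
    have hev : ∀ᶠ j : ℕ in Filter.atTop,
        bergmanProj (2 * j + r) (fun w' : UpperHalfPlane => δ w' * poincareKernel (2 * j + r) L ψ w w') w /
              (2 * bergmanKernel (2 * j + r) w w) -
            berezin (2 * j + r) δ w = -berezin (2 * j + r) δ w := by
      refine Filter.eventually_atTop.mpr ⟨k₀ + k₁ + k₂, fun j hj => ?_⟩
      rw [hvan (2 * j + r) (by omega) (by omega) (by omega) w w, zero_div, zero_sub]
    have t7 : Filter.Tendsto (fun j : ℕ => -berezin (2 * j + r) δ w) Filter.atTop (nhds 0) :=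
      t5.congr' hev
    have t8 : Filter.Tendsto (fun j : ℕ => berezin (2 * j + r) δ w) Filter.atTop (nhds 0) := by
      simpa using t7.neg
    exact tendsto_nhds_unique t6 t8
  -- density (STUB 7) + continuity: the defect vanishes identically
  have hclosed : IsClosed {w : UpperHalfPlane | δ w = 0} := isClosed_eq hδc continuous_const
  have hsub : {w : UpperHalfPlane | IsFreePoint L w} ⊆ {w : UpperHalfPlane | δ w = 0} :=
    fun w hw => hfree w hw
  have hz : z ∈ closure {w : UpperHalfPlane | δ w = 0} := by
    rw [((H₇ L).mono hsub).closure_eq]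
    exact Set.mem_univ z
  rw [hclosed.closure_eq] at hz
  have hz' : ψd * φ (γ • z) - χd * ψd * φ z = 0 := hz
  have hz'' : ψd * (φ (γ • z) - χd * φ z) = 0 := by rw [← hz']; ring
  exact sub_eq_zero.mp ((mul_eq_zero.mp hz'').resolve_left hψd0)

/-- By-name sanity check (an `example`, not a declaration): the seven stubs feed the composition. -/
example : ShadowConverse :=
  ShadowConverse_of stub_maassLiftModerateGrowth stub_shadow_eq_bergmanProj stub_bergmanProj_slash
    stub_poincareKernel_isCusp stub_offDiagonalDecay stub_berezinLocalization_moderate stub_freePointsDense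


end Summit.Langlands.Langlands.Cruxes.ShadowConverse.Defect

end
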